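import Mathlib
import Summits.ValiantsHypothesis.ValiantsHypothesis.Theses.OneNatPerBit

/-!
# Route OneNatPerBit — `SingleCutBound` (item stmt-ValiantsHypothesis-10326)

What rank gives, exactly.  For a cut `S ⊆ [n]` of the layers and a coefficient function of
cut-rank `≤ w`, `c(φ) = ∑_{b<w} L_b(φ|S)·R_b(φ|Sᶜ)` on `φ : [n] → [n]`, we prove

  `|∑_{σ ∈ S_n} c(σ)|² · C(n,|S|) ≤ w · n! · ∑_φ |c(φ)|²`,

i.e. single-cut `corr²(c, per_n) ≤ w / C(n,|S|)` — the route's record that the correlation law is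
not a rank statement (the `(S,Sᶜ)` flattening of `per_n` has `C(n,|S|)` equal singular values
`√(|S|!(n-|S|)!)`, so Eckart–Young / von Neumann give exactly this and nothing better).

## Proof (elementary; no singular values needed)

* `exists_unit_factorisation` — orthonormalise the column space: with `u_1,…,u_r` (`r ≤ w`) an
  orthonormal basis of `span{L_b} ⊆ ℓ²(S → [n])` (Mathlib's `stdOrthonormalBasis`), every column
  `c(·,β)` lies in the span, so `c(α,β) = ∑_i u_i(α) ρ_i(β)` with `ρ_i(β) = ⟪u_i, c(·,β)⟫` and
  Parseval `∑_i |ρ_i(β)|² = ∑_α |c(α,β)|²`.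
* Cauchy–Schwarz over the pairs `(σ, i)`:
  `|∑_σ c(σ)|² ≤ (∑_{σ,i} |u_i(σ|S)|²) · (∑_{σ,i} |ρ_i(σ|Sᶜ)|²)`.
* `sum_perm_restrict_le` — fibre counting: the permutations with a prescribed restriction to a
  set `T` number at most `(n-|T|)!` (a coset of the pointwise stabiliser,
  `Equiv.Perm.subtypeEquivSubtypePerm`), so the first factor is `≤ r·(n-|S|)! ≤ w·(n-|S|)!` and the
  second is `≤ |S|!·∑_β ∑_i |ρ_i(β)|² = |S|!·∑_φ |c(φ)|²`.
* `C(n,k)·k!·(n-k)! = n!` finishes.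

Sources: Nisan 1991 (rank of partial-derivative / flattening matrices for ABPs,
[Nisan1991Noncommutative]); the flat spectrum of the permanent's flattening is folklore (matrix
product states, doi:10.1103/PhysRevB.73.094423).  Nothing here is cited as a named fact: the file
is self-contained over Mathlib.
-/

-- `Summit.ValiantsHypothesis.ValiantsHypothesis.…` is the tree's mandated single-conjunct layout
-- (Sub = Summit), so the duplicated namespace component is intended.
set_option linter.dupNamespace false

namespace Summit.ValiantsHypothesis.ValiantsHypothesis.Theorems.OneNatPerBitSingleCutBound

open scoped BigOperators InnerProductSpace

/-! ### Fibre counting in the symmetric group -/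

/-- Fibre count: the permutations of `Fin n` that agree with a prescribed function `γ` on the
subtype `{i // p i}` number at most `(card {i // ¬ p i})!` (they form a coset of the pointwise
stabiliser of `{i // p i}`, which is `Perm {i // ¬ p i}`). -/
theorem card_filter_perm_restrict_eq_le {n : ℕ} (p : Fin n → Prop) [DecidablePred p]
    (γ : {i // p i} → Fin n) :
    (Finset.univ.filter (fun σ : Equiv.Perm (Fin n) => (fun i : {i // p i} => σ i) = γ)).card
      ≤ (Fintype.card {i // ¬ p i}).factorial := by
  classical
  set P : Finset (Equiv.Perm (Fin n)) :=
    Finset.univ.filter (fun σ : Equiv.Perm (Fin n) => (fun i : {i // p i} => σ i) = γ) with hPdef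
  rcases P.eq_empty_or_nonempty with hP | ⟨σ₀, hσ₀⟩
  · simp [hP]
  · have hσ₀' : ∀ i : {i // p i}, σ₀ i = γ i := fun i =>
      congrFun (Finset.mem_filter.mp hσ₀).2 i
    let Q : Finset (Equiv.Perm (Fin n)) := Finset.univ.filter (fun τ => ∀ a, ¬¬p a → τ a = a)
    have hmap : ∀ σ ∈ P, σ₀⁻¹ * σ ∈ Q := by
      intro σ hσ
      have hσ' := (Finset.mem_filter.mp hσ).2
      refine Finset.mem_filter.mpr ⟨Finset.mem_univ _, fun a ha => ?_⟩
      have ha' : p a := not_not.mp ha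
      have h1 : σ a = γ ⟨a, ha'⟩ := congrFun hσ' ⟨a, ha'⟩
      have h2 : σ₀ a = γ ⟨a, ha'⟩ := hσ₀' ⟨a, ha'⟩
      rw [Equiv.Perm.mul_apply, h1, ← h2]
      simp
    have hinj : Set.InjOn (fun σ => σ₀⁻¹ * σ) P := fun σ _ τ _ h => mul_left_cancel h
    calc P.card ≤ Q.card := Finset.card_le_card_of_injOn _ hmap hinj
      _ = Fintype.card {τ : Equiv.Perm (Fin n) // ∀ a, ¬¬p a → τ a = a} :=
          (Fintype.card_subtype _).symm
      _ = Fintype.card (Equiv.Perm {i // ¬ p i}) :=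
          (Fintype.card_congr (Equiv.Perm.subtypeEquivSubtypePerm _)).symm
      _ = (Fintype.card {i // ¬ p i}).factorial := Fintype.card_perm

/-- Fibre bound for sums: summing a nonnegative function of the restriction `σ|{p}` over all
permutations `σ` overcounts the sum over all functions `{i // p i} → Fin n` by at most the fibre
size `(card {i // ¬ p i})!`. -/
theorem sum_perm_restrict_le {n : ℕ} (p : Fin n → Prop) [DecidablePred p]
    (g : ({i // p i} → Fin n) → ℝ) (hg : ∀ γ, 0 ≤ g γ) :
    ∑ σ : Equiv.Perm (Fin n), g (fun i => σ i)
      ≤ (Fintype.card {i // ¬ p i}).factorial * ∑ γ, g γ := by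
  classical
  rw [← Finset.sum_fiberwise (Finset.univ) (fun σ : Equiv.Perm (Fin n) => (fun i : {i // p i} => σ i))
    (fun σ => g (fun i => σ i))]
  rw [Finset.mul_sum]
  refine Finset.sum_le_sum fun γ _ => ?_
  have : ∑ σ ∈ Finset.univ.filter (fun σ : Equiv.Perm (Fin n) => (fun i : {i // p i} => σ i) = γ),
      g (fun i => σ i)
      = (Finset.univ.filter (fun σ : Equiv.Perm (Fin n) => (fun i : {i // p i} => σ i) = γ)).card
        * g γ := by
    rw [Finset.sum_congr rfl (g := fun _ => g γ) (fun σ hσ => by rw [(Finset.mem_filter.mp hσ).2]),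
      Finset.sum_const, nsmul_eq_mul]
  rw [this]
  exact mul_le_mul_of_nonneg_right (by exact_mod_cast card_filter_perm_restrict_eq_le p γ) (hg γ)

/-! ### Orthonormalising a rank-`w` factorisation -/

/-- Orthonormalisation of a rank-`w` factorisation: any `∑_b L_b ⊗ R_b` can be rewritten as
`∑_{i<r} u_i ⊗ ρ_i` with `r ≤ w`, each `u_i` a unit vector of `ℓ²(I)` (in fact the `u_i` are
orthonormal) and Parseval holding column by column: `∑_i |ρ_i(β)|² = ∑_α |∑_b L_b(α) R_b(β)|²`. -/
theorem exists_unit_factorisation {I J : Type*} [Fintype I] [Fintype J] {w : ℕ}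
    (L : Fin w → I → ℂ) (R : Fin w → J → ℂ) :
    ∃ (r : ℕ) (u : Fin r → I → ℂ) (ρ : Fin r → J → ℂ), r ≤ w ∧ (∀ i, ∑ α, ‖u i α‖ ^ 2 = 1) ∧
      (∀ α β, ∑ b, L b α * R b β = ∑ i, u i α * ρ i β) ∧
      (∀ β, ∑ i, ‖ρ i β‖ ^ 2 = ∑ α, ‖∑ b, L b α * R b β‖ ^ 2) := by
  classical
  let L' : Fin w → EuclideanSpace ℂ I := fun b => WithLp.toLp 2 (L b)
  let V : Submodule ℂ (EuclideanSpace ℂ I) := Submodule.span ℂ (Set.range L')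
  let bV := stdOrthonormalBasis ℂ V
  have hr : Module.finrank ℂ V ≤ w := by
    have h := finrank_range_le_card (R := ℂ) L'
    simp only [Set.finrank, Fintype.card_fin] at h
    exact h
  have hmem : ∀ β, (∑ b, R b β • L' b) ∈ V := fun β =>
    Submodule.sum_mem _ fun b _ => Submodule.smul_mem _ _ (Submodule.subset_span ⟨b, rfl⟩)
  let c : J → V := fun β => ⟨∑ b, R b β • L' b, hmem β⟩
  have hc : ∀ α β, ((c β : V) : EuclideanSpace ℂ I) α = ∑ b, L b α * R b β := by
    intro α β
    show WithLp.ofLp (∑ b, R b β • L' b) α = _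
    rw [WithLp.ofLp_sum, Finset.sum_apply]
    refine Finset.sum_congr rfl fun b _ => ?_
    simp [L', mul_comm]
  let u : Fin (Module.finrank ℂ V) → I → ℂ := fun i α => (bV i : EuclideanSpace ℂ I) α
  let ρ : Fin (Module.finrank ℂ V) → J → ℂ := fun i β => ⟪bV i, c β⟫_ℂ
  have h1 : ∀ i, ∑ α, ‖u i α‖ ^ 2 = 1 := by
    intro i
    have h1 : ‖((bV i : V) : EuclideanSpace ℂ I)‖ = 1 :=
      (Submodule.norm_coe _).trans (bV.norm_eq_one i)
    rw [← EuclideanSpace.norm_sq_eq, h1, one_pow]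
  have h2 : ∀ α β, ∑ b, L b α * R b β = ∑ i, u i α * ρ i β := by
    intro α β
    have h := congrArg (fun v : V => (v : EuclideanSpace ℂ I) α) (bV.sum_repr' (c β))
    simp only [Submodule.coe_sum, Submodule.coe_smul] at h
    rw [hc] at h
    rw [← h, WithLp.ofLp_sum, Finset.sum_apply]
    refine Finset.sum_congr rfl fun i _ => ?_
    simp [u, ρ, mul_comm]
  have h3 : ∀ β, ∑ i, ‖ρ i β‖ ^ 2 = ∑ α, ‖∑ b, L b α * R b β‖ ^ 2 := by
    intro β
    simp only [ρ]
    rw [bV.sum_sq_norm_inner_right (c β), Submodule.coe_norm, EuclideanSpace.norm_sq_eq]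
    simp only [hc]
  exact ⟨Module.finrank ℂ V, u, ρ, hr, h1, h2, h3⟩

/-! ### Bookkeeping lemmas -/

/-- Cauchy–Schwarz for a double finite sum of real numbers. -/
theorem sum_sum_mul_sq_le {α β : Type*} [Fintype α] [Fintype β] (f g : α → β → ℝ) :
    (∑ a, ∑ b, f a b * g a b) ^ 2 ≤ (∑ a, ∑ b, f a b ^ 2) * ∑ a, ∑ b, g a b ^ 2 := by
  simpa only [Fintype.sum_prod_type] using
    Finset.sum_mul_sq_le_sq_mul_sq Finset.univ (fun x : α × β => f x.1 x.2) (fun x => g x.1 x.2)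

/-- `|{i : Fin n // i ∉ S}| = n - |S|`. -/
theorem card_subtype_not_mem {n : ℕ} (S : Finset (Fin n)) :
    Fintype.card {i : Fin n // ¬ (i ∈ S)} = n - S.card := by
  classical
  simp [Fintype.card_subtype, Finset.filter_not, Finset.card_univ_sdiff]

/-- `|{i : Fin n // ¬ i ∉ S}| = |S|`. -/
theorem card_subtype_not_not_mem {n : ℕ} (S : Finset (Fin n)) :
    Fintype.card {i : Fin n // ¬ (i ∉ S)} = S.card := by
  classical
  simp [Fintype.card_subtype]

/-- Splitting a function `φ : Fin n → Fin n` into its restrictions to `S` and to the complement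
(`Equiv.piEquivPiSubtypeProd`) turns the sum over `φ` into an iterated sum. -/
theorem sum_fun_eq_sum_sum_restrict {n : ℕ} (S : Finset (Fin n))
    (f : (S → Fin n) → ({i // i ∉ S} → Fin n) → ℝ) :
    ∑ φ : Fin n → Fin n, f (fun i => φ i) (fun i => φ i)
      = ∑ β : {i // i ∉ S} → Fin n, ∑ α : S → Fin n, f α β := by
  classical
  rw [Fintype.sum_equiv (Equiv.piEquivPiSubtypeProd (· ∈ S) (fun _ => Fin n))
      (fun φ : Fin n → Fin n => f (fun i => φ i) (fun i => φ i))
      (fun x => f x.1 x.2) (fun φ => rfl)]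
  rw [Fintype.sum_prod_type, Finset.sum_comm]

/-! ### The item -/

/-- **`SingleCutBound`** (item stmt-ValiantsHypothesis-10326 of route OneNatPerBit): for all
`n w`, every cut `S ⊆ Fin n` and all `L : Fin w → (S → Fin n) → ℂ`,
`R : Fin w → ({i // i ∉ S} → Fin n) → ℂ`, with `c(φ) = ∑_b L_b(φ|S)·R_b(φ|Sᶜ)`,
`‖∑_σ c(σ)‖² · C(n,|S|) ≤ w · n! · ∑_φ ‖c(φ)‖²`.  Proof: orthonormalise the column space
(`exists_unit_factorisation`), Cauchy–Schwarz over `(σ, i)`, fibre counts `(n-|S|)!` and `|S|!`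
(`sum_perm_restrict_le`), and `C(n,k)·k!·(n-k)! = n!`. -/
theorem singleCutBound_proof : Theses.OneNatPerBit.SingleCutBound := by
  intro n w S L R
  classical
  obtain ⟨r, u, ρ, hr, hu, hLR, hρ⟩ := exists_unit_factorisation L R
  set k := S.card with hk_def
  have hkn : k ≤ n := by simpa using S.card_le_univ
  have hcardS : Fintype.card {i : Fin n // ¬ (i ∈ S)} = n - k := card_subtype_not_mem S
  have hcardSc : Fintype.card {i : Fin n // ¬ (i ∉ S)} = k := card_subtype_not_not_mem S
  -- the Frobenius side as an iterated sum, via Parseval in the column space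
  set F := ∑ φ : Fin n → Fin n, ‖∑ b, L b (fun i => φ i) * R b (fun i => φ i)‖ ^ 2 with hF_def
  have hF : F = ∑ β : {i // i ∉ S} → Fin n, ∑ i, ‖ρ i β‖ ^ 2 := by
    rw [hF_def, sum_fun_eq_sum_sum_restrict S (fun α β => ‖∑ b, L b α * R b β‖ ^ 2)]
    exact Finset.sum_congr rfl fun β _ => (hρ β).symm
  -- Cauchy–Schwarz over (σ, i)
  set A := ∑ σ : Equiv.Perm (Fin n), ∑ i, ‖u i (fun j : S => σ j)‖ ^ 2 with hA_def
  set B := ∑ σ : Equiv.Perm (Fin n), ∑ i, ‖ρ i (fun j : {j // j ∉ S} => σ j)‖ ^ 2 with hB_def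
  have hN : ‖∑ σ : Equiv.Perm (Fin n), ∑ b, L b (fun i => σ i) * R b (fun i => σ i)‖ ^ 2
      ≤ A * B := by
    have h1 : ‖∑ σ : Equiv.Perm (Fin n), ∑ b, L b (fun i => σ i) * R b (fun i => σ i)‖
        ≤ ∑ σ : Equiv.Perm (Fin n), ∑ i,
            ‖u i (fun j : S => σ j)‖ * ‖ρ i (fun j : {j // j ∉ S} => σ j)‖ := by
      refine (norm_sum_le _ _).trans (Finset.sum_le_sum fun σ _ => ?_)
      rw [hLR]
      refine (norm_sum_le _ _).trans (Finset.sum_le_sum fun i _ => ?_)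
      rw [norm_mul]
    calc _ ≤ _ := pow_le_pow_left₀ (norm_nonneg _) h1 2
      _ ≤ A * B := sum_sum_mul_sq_le _ _
  -- the left factor: unit vectors, fibres of size (n-k)!
  have hA : A ≤ w * (n - k).factorial := by
    rw [hA_def, Finset.sum_comm]
    calc ∑ i, ∑ σ : Equiv.Perm (Fin n), ‖u i (fun j : S => σ j)‖ ^ 2
        ≤ ∑ _i : Fin r, ((n - k).factorial : ℝ) := by
          refine Finset.sum_le_sum fun i _ => ?_
          have h := sum_perm_restrict_le (· ∈ S) (fun γ => ‖u i γ‖ ^ 2) (fun γ => by positivity)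
          rw [hcardS] at h
          -- `convert` bridges the two (propositionally equal) `Fintype (S → Fin n)` instances
          have h2 : ∑ σ : Equiv.Perm (Fin n), ‖u i (fun j : S => σ j)‖ ^ 2
              ≤ ((n - k).factorial : ℝ) * ∑ α, ‖u i α‖ ^ 2 := by
            convert h using 4
          rw [hu i, mul_one] at h2
          exact h2
      _ = r * (n - k).factorial := by simp
      _ ≤ w * (n - k).factorial := by
          exact mul_le_mul_of_nonneg_right (by exact_mod_cast hr) (by positivity)
  -- the right factor: fibres of size k!, then Parseval
  have hB : B ≤ k.factorial * F := by
    rw [hF, hB_def]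
    have h := sum_perm_restrict_le (· ∉ S) (fun β => ∑ i, ‖ρ i β‖ ^ 2) (fun β => by positivity)
    rw [hcardSc] at h
    exact h
  -- bookkeeping: C(n,k)·k!·(n-k)! = n!
  have hfact : ((n.choose k : ℕ) : ℝ) * k.factorial * (n - k).factorial = n.factorial := by
    exact_mod_cast Nat.choose_mul_factorial_mul_factorial hkn
  have hB0 : 0 ≤ B := by positivity
  calc ‖∑ σ : Equiv.Perm (Fin n), ∑ b, L b (fun i => σ i) * R b (fun i => σ i)‖ ^ 2
        * (n.choose k : ℝ)
      ≤ (A * B) * (n.choose k : ℝ) := mul_le_mul_of_nonneg_right hN (by positivity)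
    _ ≤ ((w * (n - k).factorial) * (k.factorial * F)) * (n.choose k : ℝ) :=
        mul_le_mul_of_nonneg_right (mul_le_mul hA hB hB0 (by positivity)) (by positivity)
    _ = w * (((n.choose k : ℕ) : ℝ) * k.factorial * (n - k).factorial) * F := by ring
    _ = w * n.factorial * F := by rw [hfact]

end Summit.ValiantsHypothesis.ValiantsHypothesis.Theorems.OneNatPerBitSingleCutBound
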